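import Summits.NavierStokesRegularity.FluidComputer.GateBudgetColdWindow
import HarnessLib

/-!
# What no tuning can beat, part 40: THE OUTPUT PAIR OF EVERY MEMBER IS FROZEN ON THE COLD
# WINDOW — `|d(t)² + ã(t)² - (d(T)² + ã(T)²)| ≤ 3/K⁹` on `[T, T + 2.8282]` for EVERY member,
# the output cap LOSES ITS PIN (`ã² ≤ (|sin wπ| + 0.07|cos wπ| + 10⁻³)² + 10⁻⁶ + 3/K⁹` on
# `[0, t₋ + 2.8282]`), and a lattice dud's whole output pair stays `≤ 0.00505` there

Cell `pub-fluidc`, blueprint seat bp1 (gen 33, first item); same namespace and conventions as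
parts 1–39 (`GateBudget*.lean`); imports part 39 (`GateBudgetColdWindow`: the doused state of
every member with its six-digit clock and its cold trigger `c < ρ²/K⁹` on `[T, T + 2.8282]`).
Headline amplifier `M = K¹⁰`, `K ≥ 16`, `ε² ≤ 1/(6K²⁰)`, window `200ε/K²⁰ ≤ ρ² ≤ 2ε/K¹⁰`, an
exact trajectory of `rotorCircuit K K¹⁰ ε ρ` from (5.6) with a catalyst clock `C` (`C' = c`);
NO lattice condition except in §124. Modes `0 = a`, `1 = b` clock, `2 = c` trigger, `3 = d`,
`4 = ã`; `w = ε/(K¹⁰ρ²)`; `t₋ = √(2 - 24 log K/K¹⁰)`, `t₊ = √(2 + 2/K¹⁰) + 242/K⁹`.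
HONEST FRAMING (verbatim): low prior, high value-of-information experiment on Tao's machine
paradigm; NOT a claim that NS blows up. Nothing is proved about the Navier–Stokes equations.

WHAT (SPEC-INPUT-bp1 §AM item (19f), the successor menu of part 39: the pin-free half of the
spent-or-silent alternative). Parts 31/33/39 capped the OUTPUT `ã` of a member on the debt /
cold window only BEHIND ITS PIN `L' = 0.99755|cos wπ| - 0.07|sin wπ| - 10⁻³ ≥ 0` (the cap came
through the carrier: `ã² ≤ 1 - a²`). This file reads the output PAIR instead: by (dora) the
drain cancels inside `d² + ã²`, whose only feed is the rotor, `∂ₜ(d² + ã²) = 2Rcad` with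
`|2ad| ≤ a² + d² ≤ 1` (energy-con) and `c ≥ 0` — so under ANY trigger cap `c ≤ c₁` on
`[T, T']` (`T ≥ 0`) the pair moves by at most `Rc₁(t - T)` IN EITHER DIRECTION (§120
`cold_output_frozen`, every coupling `(ε, σ ≥ 0, μ, R ≥ 0, K)`; part 36's
`rearm_output_apriori` is its upper half; §121 `knob_output_frozen`, every `rotorCircuit K M ε
ρ`, bound `(c₁/ρ²)(t - T)`). On part 39's cold window `c < ρ²/K⁹`, `R = ρ⁻²`, length
`2.8282`: the pair of EVERY member is frozen to `3/K⁹` at its exit value, which §115 brackets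
by `w` alone. §122 `knob_member_output_cold` (EVERY member, absolute clock `[t₊, t₋ +
2.8282]`): `max(0.99755|sin wπ| - 0.07|cos wπ| - 10⁻³, 0)² - 3/K⁹ ≤ d(t)² + ã(t)² ≤ (|sin wπ|
+ 0.07|cos wπ| + 10⁻³)² + 10⁻⁶ + 3/K⁹`. §123 `knob_member_cap_free` (EVERY member, NO pin):
`ã(t)² ≤ (|sin wπ| + 0.07|cos wπ| + 10⁻³)² + 10⁻⁶ + 3/K⁹` for every `t ∈ [0, t₋ + 2.8282]` —
before `T` the output is monotone below `ã(T) ≤ 10⁻³`, after `T` it is a summand of the frozen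
pair; at `|cos wπ| = 1` this reads `0.00505` where §117's pinned cap read `0.0069`, and it needs
no hypothesis on `w`. §124 `knob_dud_output_cold` (LATTICE `ε = k·K¹⁰ρ²`): `d(t)² + ã(t)² ≤
101/20000` on `[t₊, t₋ + 2.8282]` and `ã(t)² ≤ 101/20000` on `[0, t₋ + 2.8282]` — part 39's
§118 had `1/100`; the dud carries at most `0.071²(1 + 2·10⁻³)` of the energy in its output pair
for the whole cold window, i.e. until its second pulse (§119: it begins after `t₋ + 2.8282`).

HONEST LIMITS. (i) Frozen means to `3/K⁹ ≤ 4.4·10⁻¹¹` over the typed cold window `2.8282 =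
2β/ε`, `β = 1.4141ε` (part 39's limits (i)–(ii) apply verbatim); inside the pair the drain DOES
move energy `d → ã` (`ã' = Kd²`), which this file does not track. (ii) The brackets are §115's
exit pins `±(0.07|cos wπ| + 10⁻³)` read through squares: near the half-lattice (`|sin wπ| ≈ 1`)
the upper bound exceeds `1` and says nothing (parts 34/35 own the teeth: `d² + ã² ≥ 0.993` on
`[t₊, t₋ + 100]`); near the lattice the lower bound is `0`. (iii) `M = K¹⁰`, `K ≥ 16` in
§122–§124; §120–§121 are coupling-free. (iv) Nothing about Navier–Stokes.
[cite: Tao2016AveragedNS, §5.5 Theorem 5.3, (5.5), (5.6), (dora), (energy-con)]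
-/

noncomputable section

namespace Summit.NavierStokesRegularity.FluidComputer.GateBudget

open Real Set Filter Topology
open Literature.Analysis.FluidPDE.Tao2016AveragedNS
open Literature.Analysis.FluidPDE.Tao2016AveragedNS.Thm53 (monotoneOn_sub_of_le_deriv)

variable {K ε σ μ R ρ : ℝ} {X : ℝ → Fin 5 → ℝ} {C : ℝ → ℝ}

/-! ## §120 The output pair under a capped trigger moves by at most `Rc₁(t - T)` either way -/

/-- **THE OUTPUT PAIR IS FROZEN UNDER A CAPPED TRIGGER.** Any couplings with `σ, R ≥ 0`, the
trajectory from (5.6), `T ≥ 0` and the trigger capped on `[T, T']` (`c ≤ c₁` there): for every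
`t ∈ [T, T']`, `|d(t)² + ã(t)² - (d(T)² + ã(T)²)| ≤ Rc₁(t - T)` — `∂ₜ(d² + ã²) = 2Rcad` (dora),
`c ≥ 0` after `0`, `|2ad| ≤ a² + d² ≤ 1` (energy-con). The upper half is part 36's
`rearm_output_apriori` (slope `0`); the lower half is new.
[cite: Tao2016AveragedNS, §5.5 (5.5), (dora), (energy-con)] -/
theorem cold_output_frozen (hX : ∀ t, HasDerivAt X (fiveGateCircuit ε σ μ R K (X t)) t)
    (h0 : X 0 = delayInit) (hσ : 0 ≤ σ) (hR : 0 ≤ R) {T T' c₁ : ℝ} (hT : 0 ≤ T)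
    (hc : ∀ r ∈ Icc T T', X r 2 ≤ c₁) {t : ℝ} (ht : t ∈ Icc T T') :
    |X t 3 ^ 2 + X t 4 ^ 2 - (X T 3 ^ 2 + X T 4 ^ 2)| ≤ R * c₁ * (t - T) := by
  have hup := rearm_output_apriori hX h0 hσ hR hT (c₀ := c₁) (s := 0)
    (fun r hr => by simpa using hc r hr) ht
  have hmono := monotoneOn_sub_of_le_deriv (f := fun r => X r 3 ^ 2 + X r 4 ^ 2)
    (f' := fun r => 2 * R * X r 2 * X r 0 * X r 3)
    (φ := fun _ => -(R * c₁) * 1) (Φ := fun r => -(R * c₁) * (r - T))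
    (convex_Icc T T') (fun r _ => out_energy (hX r))
    (fun r _ => ((hasDerivAt_id' r).sub_const T).const_mul (-(R * c₁)))
    (fun r hr => by
      have hc0 : 0 ≤ X r 2 := c_nonneg hX h0 hσ (hT.trans hr.1)
      have hE : X r 0 ^ 2 + X r 1 ^ 2 + X r 2 ^ 2 + X r 3 ^ 2 + X r 4 ^ 2 = 1 := by
        simpa [energy, Fin.sum_univ_five] using energy_init hX h0 r
      have had : -1 ≤ 2 * (X r 0 * X r 3) := by
        nlinarith [sq_nonneg (X r 0 + X r 3), sq_nonneg (X r 1), sq_nonneg (X r 2),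
          sq_nonneg (X r 4)]
      show -(R * c₁) * 1 ≤ 2 * R * X r 2 * X r 0 * X r 3
      have h1 : -(R * X r 2) ≤ 2 * R * X r 2 * X r 0 * X r 3 := by
        have := mul_le_mul_of_nonneg_left had (mul_nonneg hR hc0)
        nlinarith [this]
      have h2 : R * X r 2 ≤ R * c₁ := mul_le_mul_of_nonneg_left (hc r hr) hR
      linarith)
  have h := hmono (left_mem_Icc.2 (ht.1.trans ht.2)) ht ht.1
  dsimp only at h
  have e1 : -(R * c₁) * (T - T) = 0 := by ring
  have e2 : R * (c₁ * (t - T) + 0 * (t - T) ^ 2 / 2) = R * c₁ * (t - T) := by ring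
  have e3 : -(R * c₁) * (t - T) = -(R * c₁ * (t - T)) := by ring
  rw [abs_le]
  exact ⟨by linarith only [h, e1, e3], by linarith only [hup, e2]⟩

/-! ## §121 The same on the knob family: `(c₁/ρ²)(t - T)` -/

/-- **THE OUTPUT PAIR OF A KNOB CIRCUIT UNDER A CAPPED TRIGGER.** Any `rotorCircuit K M ε ρ`
(`ρ > 0`, any `K, M, ε`), the trajectory from (5.6), `T ≥ 0`, and `c ≤ c₁` on `[T, T + H]`:
`|d(t)² + ã(t)² - (d(T)² + ã(T)²)| ≤ (c₁/ρ²)(t - T)` there — §120 at `σ = ρ²e^{-M}`,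
`R = ρ⁻²`. [cite: Tao2016AveragedNS, §5.5 (5.5), (dora), (energy-con)] -/
theorem knob_output_frozen {M : ℝ}
    (hX : ∀ t, HasDerivAt X (RotorKnob.rotorCircuit K M ε ρ (X t)) t)
    (h0 : X 0 = delayInit) (hρ : 0 < ρ) {T H c₁ : ℝ} (hT : 0 ≤ T)
    (hc : ∀ r ∈ Icc T (T + H), X r 2 ≤ c₁) :
    ∀ t ∈ Icc T (T + H),
      |X t 3 ^ 2 + X t 4 ^ 2 - (X T 3 ^ 2 + X T 4 ^ 2)| ≤ c₁ / ρ ^ 2 * (t - T) := by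
  have hXf := hX
  rw [RotorKnob.rotorCircuit_eq_fiveGate] at hXf
  intro t ht
  have h := cold_output_frozen hXf h0 (by positivity) (by positivity) hT hc ht
  rw [show c₁ / ρ ^ 2 * (t - T) = (ρ ^ 2)⁻¹ * c₁ * (t - T) by rw [div_eq_mul_inv]; ring]
  exact h

/-! ## §122 The output pair of every member on the cold window, by `w` alone -/

/-- **THE OUTPUT PAIR OF EVERY MEMBER IS FROZEN ON THE COLD WINDOW.** `K ≥ 16`, `0 < ε`,
`ε² ≤ 1/(6K²⁰)`, an exact trajectory of `rotorCircuit K K¹⁰ ε ρ` from (5.6) with `200ε/K²⁰ ≤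
ρ² ≤ 2ε/K¹⁰` (ANY member; `w = ε/(K¹⁰ρ²)`): for EVERY `t ∈ [t₊, t₋ + 2.8282]`,
`max(0.99755|sin wπ| - 0.07|cos wπ| - 10⁻³, 0)² - 3/K⁹ ≤ d(t)² + ã(t)² ≤ (|sin wπ| +
0.07|cos wπ| + 10⁻³)² + 10⁻⁶ + 3/K⁹` — §121 on part 39's cold window (`c < ρ²/K⁹` on `[T, T +
2.8282] ⊇ [t₊, t₋ + 2.8282]`) around §115's exit brackets of `|d(T)|` and `ã(T) ≤ 10⁻³`.
[cite: Tao2016AveragedNS, §5.5 Theorem 5.3, (5.5), (5.6), (dora), (energy-con)] -/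
theorem knob_member_output_cold
    (hX : ∀ t, HasDerivAt X (RotorKnob.rotorCircuit K (K ^ 10) ε ρ (X t)) t)
    (h0 : X 0 = delayInit) (hC : ∀ t, HasDerivAt C (X t 2) t) (hK : 16 ≤ K) (hε : 0 < ε)
    (hεK : ε ^ 2 ≤ 1 / (6 * K ^ 20)) (hρ : 0 < ρ) (hlo : 200 * ε / K ^ 20 ≤ ρ ^ 2)
    (hhi : K ^ 10 * ρ ^ 2 ≤ 2 * ε) :
    ∀ t ∈ Icc (√(2 + 2 / K ^ 10) + 242 / K ^ 9)
        (√(2 - 24 * Real.log K / K ^ 10) + 28282 / 10000),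
      max (19951 / 20000 * |sin (ε / (K ^ 10 * ρ ^ 2) * π)|
            - 7 / 100 * |cos (ε / (K ^ 10 * ρ ^ 2) * π)| - 1 / 1000) 0 ^ 2 - 3 / K ^ 9
          ≤ X t 3 ^ 2 + X t 4 ^ 2 ∧
      X t 3 ^ 2 + X t 4 ^ 2 ≤ (|sin (ε / (K ^ 10 * ρ ^ 2) * π)|
            + 7 / 100 * |cos (ε / (K ^ 10 * ρ ^ 2) * π)| + 1 / 1000) ^ 2
          + 1 / 1000000 + 3 / K ^ 9 := by
  have hK0 : 0 < K := by linarith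
  have hK9 : 0 < K ^ 9 := by positivity
  obtain ⟨s₀, T, -, -, hs1, -, hsT, -, hlow, hTt, -, -, he4, -, hd, -, hd', -, -, hcold⟩ :=
    knob_member_doused_cold hX h0 hC hK hε hεK hρ hlo hhi
  have hT0 : 0 ≤ T := by linarith only [hs1, hsT]
  have hXf := hX
  rw [RotorKnob.rotorCircuit_eq_fiveGate] at hXf
  have he0 : 0 ≤ X T 4 := e_nonneg hXf h0 hK0.le hT0
  have heT : X T 4 ^ 2 ≤ 1 / 1000000 := by nlinarith only [he0, he4]
  have hdT : X T 3 ^ 2 ≤ (|sin (ε / (K ^ 10 * ρ ^ 2) * π)|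
      + 7 / 100 * |cos (ε / (K ^ 10 * ρ ^ 2) * π)| + 1 / 1000) ^ 2 := by
    rw [← sq_abs]; exact pow_le_pow_left₀ (abs_nonneg _) hd 2
  have hdT' : max (19951 / 20000 * |sin (ε / (K ^ 10 * ρ ^ 2) * π)|
      - 7 / 100 * |cos (ε / (K ^ 10 * ρ ^ 2) * π)| - 1 / 1000) 0 ^ 2 ≤ X T 3 ^ 2 := by
    have h := pow_le_pow_left₀ (le_max_right _ _) (max_le hd' (abs_nonneg _)) 2
    rwa [sq_abs] at h
  have hfro := knob_output_frozen hX h0 hρ hT0 (H := 28282 / 10000) (c₁ := ρ ^ 2 / K ^ 9)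
    (fun r hr => (hcold r hr).le)
  have hγ : ρ ^ 2 / K ^ 9 / ρ ^ 2 = 1 / K ^ 9 := by
    field_simp
  intro t ht
  have ht' : t ∈ Icc T (T + 28282 / 10000) :=
    ⟨hTt.trans ht.1, by linarith only [ht.2, hlow, hsT]⟩
  have h := hfro t ht'
  rw [hγ, abs_le] at h
  have h3 : 1 / K ^ 9 * (t - T) ≤ 3 / K ^ 9 := by
    rw [show (3 : ℝ) / K ^ 9 = 1 / K ^ 9 * 3 by ring]
    exact mul_le_mul_of_nonneg_left (by linarith only [ht'.2]) (one_div_pos.2 hK9).le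
  exact ⟨by linarith only [h.1, h3, hdT', sq_nonneg (X T 4)],
    by linarith only [h.2, h3, hdT, heT]⟩

/-! ## §123 The output cap of every member, without the pin -/

/-- **THE OUTPUT CAP LOSES ITS PIN.** Same hypotheses (ANY member, NO condition on `w`):
`ã(t)² ≤ (|sin wπ| + 0.07|cos wπ| + 10⁻³)² + 10⁻⁶ + 3/K⁹` for EVERY `t ∈ [0, t₋ + 2.8282]` —
on `[0, T]` the output is monotone (`ã' = Kd² ≥ 0`) below `ã(T) ≤ 10⁻³`; on `[T, t₋ + 2.8282]`
it is a summand of the frozen pair (§122). Part 39's §117 needed the pin `0.99755|cos wπ| -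
0.07|sin wπ| - 10⁻³ ≥ 0` and read `1 - L'² + 3/K¹⁰`.
[cite: Tao2016AveragedNS, §5.5 Theorem 5.3, (5.5), (5.6), (dora), (ta-eq), (energy-con)] -/
theorem knob_member_cap_free
    (hX : ∀ t, HasDerivAt X (RotorKnob.rotorCircuit K (K ^ 10) ε ρ (X t)) t)
    (h0 : X 0 = delayInit) (hC : ∀ t, HasDerivAt C (X t 2) t) (hK : 16 ≤ K) (hε : 0 < ε)
    (hεK : ε ^ 2 ≤ 1 / (6 * K ^ 20)) (hρ : 0 < ρ) (hlo : 200 * ε / K ^ 20 ≤ ρ ^ 2)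
    (hhi : K ^ 10 * ρ ^ 2 ≤ 2 * ε) :
    ∀ t ∈ Icc 0 (√(2 - 24 * Real.log K / K ^ 10) + 28282 / 10000),
      X t 4 ^ 2 ≤ (|sin (ε / (K ^ 10 * ρ ^ 2) * π)|
            + 7 / 100 * |cos (ε / (K ^ 10 * ρ ^ 2) * π)| + 1 / 1000) ^ 2
          + 1 / 1000000 + 3 / K ^ 9 := by
  have hK0 : 0 < K := by linarith
  have hK9 : 0 < K ^ 9 := by positivity
  obtain ⟨s₀, T, -, -, hs1, -, hsT, -, hlow, hTt, -, -, he4, -, hd, -, -, -, -, hcold⟩ :=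
    knob_member_doused_cold hX h0 hC hK hε hεK hρ hlo hhi
  have hT0 : 0 ≤ T := by linarith only [hs1, hsT]
  have hXf := hX
  rw [RotorKnob.rotorCircuit_eq_fiveGate] at hXf
  have he0 : 0 ≤ X T 4 := e_nonneg hXf h0 hK0.le hT0
  have heT : X T 4 ^ 2 ≤ 1 / 1000000 := by nlinarith only [he0, he4]
  have hdT : X T 3 ^ 2 ≤ (|sin (ε / (K ^ 10 * ρ ^ 2) * π)|
      + 7 / 100 * |cos (ε / (K ^ 10 * ρ ^ 2) * π)| + 1 / 1000) ^ 2 := by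
    rw [← sq_abs]; exact pow_le_pow_left₀ (abs_nonneg _) hd 2
  have hfro := knob_output_frozen hX h0 hρ hT0 (H := 28282 / 10000) (c₁ := ρ ^ 2 / K ^ 9)
    (fun r hr => (hcold r hr).le)
  have hγ : ρ ^ 2 / K ^ 9 / ρ ^ 2 = 1 / K ^ 9 := by
    field_simp
  have h30 : (0 : ℝ) ≤ 3 / K ^ 9 := by positivity
  intro t ht
  rcases le_total t T with htT | hTle
  · -- before the dousing time: `0 ≤ ã(t) ≤ ã(T) ≤ 10⁻³`
    have h1 : 0 ≤ X t 4 := e_nonneg hXf h0 hK0.le ht.1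
    have h2 : X t 4 ≤ X T 4 := e_monotone hXf hK0.le htT
    have h4 : X t 4 ^ 2 ≤ 1 / 1000000 := by nlinarith only [h1, h2, he4]
    nlinarith only [h4, h30, sq_nonneg (|sin (ε / (K ^ 10 * ρ ^ 2) * π)|
      + 7 / 100 * |cos (ε / (K ^ 10 * ρ ^ 2) * π)| + 1 / 1000)]
  · -- on the cold window: a summand of the frozen pair
    have ht' : t ∈ Icc T (T + 28282 / 10000) := ⟨hTle, by linarith only [ht.2, hlow, hsT]⟩
    have h := hfro t ht'
    rw [hγ, abs_le] at h
    have h3 : 1 / K ^ 9 * (t - T) ≤ 3 / K ^ 9 := by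
      rw [show (3 : ℝ) / K ^ 9 = 1 / K ^ 9 * 3 by ring]
      exact mul_le_mul_of_nonneg_left (by linarith only [ht'.2]) (one_div_pos.2 hK9).le
    nlinarith only [h.2, h3, hdT, heT, sq_nonneg (X t 3)]

/-! ## §124 A lattice dud's output pair holds at most `0.00505` until its second pulse -/

/-- **THE OUTPUT PAIR OF A LATTICE DUD ON THE COLD WINDOW.** Same hypotheses ON the lattice
`ε = kK¹⁰ρ²` (`k ∈ ℕ`; `sin kπ = 0`, `|cos kπ| = 1`): `d(t)² + ã(t)² ≤ 101/20000` for every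
`t ∈ [t₊, t₋ + 2.8282]` (§122) and `ã(t)² ≤ 101/20000` for every `t ∈ [0, t₋ + 2.8282]`
(§123) — `0.071² + 10⁻⁶ + 3/K⁹ ≤ 0.00505`; part 39's §118 read `1/100`, and §119 there dates
the dud's second pulse after `t₋ + 2.8282`: until it re-fires, a dud of the lattice holds at
most `0.071²(1 + 2·10⁻³)` of the energy in its output pair.
[cite: Tao2016AveragedNS, §5.5 Theorem 5.3, (5.5), (5.6), (dora), (energy-con)] -/
theorem knob_dud_output_cold
    (hX : ∀ t, HasDerivAt X (RotorKnob.rotorCircuit K (K ^ 10) ε ρ (X t)) t)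
    (h0 : X 0 = delayInit) (hC : ∀ t, HasDerivAt C (X t 2) t) (hK : 16 ≤ K) (hε : 0 < ε)
    (hεK : ε ^ 2 ≤ 1 / (6 * K ^ 20)) (hρ : 0 < ρ) (hlo : 200 * ε / K ^ 20 ≤ ρ ^ 2)
    (hhi : K ^ 10 * ρ ^ 2 ≤ 2 * ε) (k : ℕ) (hk : ε = k * K ^ 10 * ρ ^ 2) :
    (∀ t ∈ Icc (√(2 + 2 / K ^ 10) + 242 / K ^ 9)
        (√(2 - 24 * Real.log K / K ^ 10) + 28282 / 10000), X t 3 ^ 2 + X t 4 ^ 2 ≤ 101 / 20000) ∧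
    (∀ t ∈ Icc 0 (√(2 - 24 * Real.log K / K ^ 10) + 28282 / 10000),
        X t 4 ^ 2 ≤ 101 / 20000) := by
  have hK0 : 0 < K := by linarith
  have h9 : (68719476736 : ℝ) ≤ K ^ 9 := by
    have := headline_pow_floor hK 9; norm_num at this; exact this
  have hw : ε / (K ^ 10 * ρ ^ 2) = k := by
    rw [div_eq_iff (by positivity), hk]; ring
  have hs : |sin (ε / (K ^ 10 * ρ ^ 2) * π)| = 0 := by
    rw [hw, Real.sin_nat_mul_pi, abs_zero]
  have hc : |cos (ε / (K ^ 10 * ρ ^ 2) * π)| = 1 := by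
    rw [hw]; exact_mod_cast Real.abs_cos_int_mul_pi k
  have hpair := knob_member_output_cold hX h0 hC hK hε hεK hρ hlo hhi
  have hcap := knob_member_cap_free hX h0 hC hK hε hεK hρ hlo hhi
  rw [hs, hc] at hpair hcap
  have h3 : (3 : ℝ) / K ^ 9 ≤ 3 / 68719476736 :=
    div_le_div_of_nonneg_left (by norm_num) (by norm_num) h9
  have hn : ((0 : ℝ) + 7 / 100 * 1 + 1 / 1000) ^ 2 + 1 / 1000000 + 3 / 68719476736
      ≤ 101 / 20000 := by norm_num
  exact ⟨fun t ht => by linarith only [(hpair t ht).2, h3, hn],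
    fun t ht => by linarith only [hcap t ht, h3, hn]⟩

end Summit.NavierStokesRegularity.FluidComputer.GateBudget
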